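import Summits.HodgeConjecture.HodgeConjecture.Theorems.VHCAbelianSchemesRoadWeilLineThroughAnchor
import Summits.HodgeConjecture.HodgeConjecture.Theorems.Ring2AbelianAllOneSplitWeilAnchorCarrierDefs
import Summits.HodgeConjecture.HodgeConjecture.Theorems.Ring2AbelianAllCMAlgebraicCarriersDefs
import Summits.HodgeConjecture.HodgeConjecture.Theorems.Ring2DeformCompactPencils
import Summits.HodgeConjecture.HodgeConjecture.Theses.VHCAbelianSchemesRoad
import HarnessLib

/-!
# Ring 2 / AbelianAll (André column) — split Weil classes (every CM field), `HC_CM` and `HC_AV` (with `HC_CM` idle) FROM ONE CARRIED CLASS AT ONE SPLIT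
# ANCHOR OF OUR CHOICE PER TYPE — the rows of PART AF on the cell's named decls (leaf file); the André column's `B_min` of gen 63

research route, not a corollary; conditional on HC_CM plus one named minimal statement.

LEAF FILE (imports the route file; nothing should import it). PART AF: the Weil family of Deligne's proof of Thm. 4.8 ∕ André's proof of Lemme 6.3.3 passes
through a PRESCRIBED split anchor ON THE NOSE and reaches every split `E`-Weil structure of the same type `(R, e₀, p)` up to `E`-isogeny (Literature
`andre1996_weilLineFamily_throughSplitAnchor`, statement only; arbitrary CM field `E`), so the ANCHOR ENGINE (`VHCAbelianSchemesRoadWeilLineThroughAnchor`,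
route-free) needs ONE carried class at ONE anchor OF OUR CHOICE per type — the node `OneSplitWeilAnchorTwistedCarriers R e₀ p` ∕ `…All` (Defs file):

* §1 **`W_E(B) ⊗ ℂ` algebraic ⟸ K-C ∧ `TwistedPerfectDoor` ∧ the family fact ∧ `OneSplitWeilAnchorTwistedCarriers R e₀ p`** for every split datum `(B, η, e, a)` of type
  `(R, e₀, p)`, `p > 1`; the three argument-free cells (`(6,3)` quadratic — preprint-expected; `(8,2)` quartic and `(8,4)` quadratic — open) with their rows;
* §2 **`AndreSplitWeilClasses ⟸ K-C ∧ TwistedPerfectDoor ∧ the family fact ∧ OneSplitWeilAnchorTwistedCarriersAll`** (`p = 1` Lefschetz; `p ≥ 2` §1, the datum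
  itself witnessing that its type is inhabited);
* §3 **`HC_CM ⟸ K-C ∧ TwistedPerfectDoor ∧ Kodaira ∧ the family fact ∧ OneSplitWeilAnchorTwistedCarriersAll`** (Lemme 6.3.2 = André 1992 is CorCM's KERNEL theorem);
* §4 **`HC_AV ⟸ K-C ∧ TwistedPerfectDoor ∧ Kodaira ∧ AndreCMAnchoredPencil ∧ the family fact ∧ CMAlgebraicTwistedCarriers ∧ OneSplitWeilAnchorTwistedCarriersAll`** —
  THE ANDRÉ COLUMN'S `B_min` OF GEN 63 (`HC_CM` IDLE): gen 62's «one carried class at EVERY tensor structure over an anchor variety per codimension» shrinks to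
  «one carried class at ONE split anchor of our choice per type `(E, p)`», and the `(E quadratic, p = 3)` conjunct is Markman's theorem (preprint) modulo typing.

HONEST: every carrier node is OPEN (the `(6,3)` quadratic cell preprint-expected), NOT implied by the Hodge conjecture (sheaves, not cycles); PART AE's no-go
applies (no split ∕ semi-homogeneous ∕ `𝒪_Z`-summand object at a Weil-type point). The family fact, Kodaira's embedding theorem and Lemme 6.3.1 enter BY NAME
(theorems in print); K-C and the door are the road's binders. Nothing here says any carrier, door, Weil class, `HC_CM`, `HC_AV` or HC holds.
References: [cite: Andre1996Motifs, §6.3 a)–c), Lemmes 6.3.1–6.3.3 and proof of 6.3.3 (pp. 31–33)] [cite: Deligne1982HodgeCycles, §4 proof of Thm. 4.8 (clauses (a)–(c)), Cor. 4.2]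
[cite: Landherr1936HermitianForms] [cite: Andre1992HodgeCM, Théorème] [cite: MoonenZarhin1998WeilClasses, §1] [cite: Markman2025SecantWeil, Thm. 1.4.1, §1.2, §1.5 and Thm. 1.5.1]
[cite: Markman2025SecantRealMultiplication, §1.1] [cite: Bloch1972Semiregularity, Remark (7.5)] [cite: BuchweitzFlenner2003, §5 Thm. 5.1] [cite: Pridham2024Semiregularity, Cor. 2.25 and Rem. 2.26–2.27]
[cite: Huybrechts2005, Prop. 5.3.1, Cor. 5.3.3] [cite: Milne1999, §7 p. 72].
-/

noncomputable section

open CategoryTheory CategoryTheory.Limits AlgebraicGeometry Topology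

namespace Summit.HodgeConjecture.HodgeConjecture.Ring2.AbelianAll

-- the cell's namespace repeats the summit name (`Summit.HodgeConjecture.HodgeConjecture…`), as in every `Ring2*` file
set_option linter.dupNamespace false

open Literature.AlgebraicGeometry Literature.AlgebraicGeometry.Motives
open Literature.AlgebraicGeometry.HodgeTheory
open Literature.AlgebraicGeometry.Deligne1982
open Literature.AlgebraicGeometry.VanGeemen1994 (pullbackOne)
open Literature.AlgebraicTopology.SingularHomology
open Literature.AlgebraicGeometry.Milne1999 (IsOfCMType CMHodgeHypothesisAt)
open Literature.AlgebraicGeometry.Andre1996 (andre1996_cmAnchoredPencil andre1996_weilLineFamily_throughSplitAnchor)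
open Summit.Ventures.HSemireg (ObjClass LocalVariationalHodgeFor)
open Summit.HodgeConjecture.HodgeConjecture.Theses
open Summit.HodgeConjecture.HodgeConjecture.Ring2.SemiregularRepresentatives (AnchoredCarrierAt twistedPerfectDoorVHC_iff_localVariationalHodgeFor
  weilClassesField_le_algebraicClasses_of_throughSplitAnchor_of_door_of_carriedAtAnchor cmHodgeHypothesisAt_of_kodaira_of_andreSplitWeilClasses
  forall_hodgeConjectureFor_of_kodaira_of_andre1996_of_andreSplitWeilClasses_of_door_of_cmAlgebraic)

variable {p : ℕ} {B : AbelianVariety ℂ} {η : B ⟶ B} {R : Polynomial ℤ} {e₀ : ℕ}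
  {e : ProjectiveEmbedding B.X} {a : complexBetti (projectiveSpace e.n ℂ) 2}

/-! ## §1 Split `E`-Weil classes of type `(R, e₀, p)` from ONE carried class at ONE split anchor of that type -/

/-- **`W_E(B) ⊗ ℂ` algebraic ⟸ the door for `𝒪` ∧ the family fact ∧ `OneSplitWeilAnchorCarriers 𝒪 R e₀ p`**, for every split `E`-Weil datum `(B, η, e, a)` of type
`(R, e₀, p)`, `p > 1` (door-generic form). [cite: Andre1996Motifs, proof of Lemme 6.3.3 (p. 33)] [cite: Deligne1982HodgeCycles, §4 proof of Thm. 4.8]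
[cite: MoonenZarhin1998WeilClasses, §1] [cite: Bloch1972Semiregularity, Remark (7.5)] -/
theorem weilClassesField_le_algebraicClasses_of_split_of_throughSplitAnchor_of_door_of_oneSplitWeilAnchorCarriers {𝒪 : ObjClass}
    (h : andre1996_weilLineFamily_throughSplitAnchor) (hT : LocalVariationalHodgeFor 𝒪) (hone : OneSplitWeilAnchorCarriers 𝒪 R e₀ p) (hp : 1 < p)
    (hB : IsWeilTypeCM B η R e₀ p) (ha : IsRationalClass a) (ha₀ : a ≠ 0)
    (hRos : ∀ x y : complexBetti B.X 1,
      polarizationPairingOne B.X (complexBetti.map e.ι 2 a) (B.dim - 1) (pullbackOne B η x) y =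
        -polarizationPairingOne B.X (complexBetti.map e.ι 2 a) (B.dim - 1) x (pullbackOne B η y))
    (hsplit : IsHyperbolicWeilType B η (p * e₀) (complexBetti.map e.ι 2 a)) :
    weilClassesField B η (R.comp (Polynomial.X ^ 2)) (2 * p) ≤ algebraicClasses B.X p := by
  obtain ⟨X₀, η₀, e', a', w₀, hX₀, ha', ha'₀, hRos₀, hsplit₀, hw₀W, hw₀Q, hw₀0, hcar⟩ := hone
  exact weilClassesField_le_algebraicClasses_of_throughSplitAnchor_of_door_of_carriedAtAnchor h hT hp hX₀ ha' ha'₀ hRos₀ hsplit₀ hw₀W hw₀Q hw₀0 hcar hB ha ha₀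
    hRos hsplit

/-- **`W_E(B) ⊗ ℂ` algebraic ⟸ K-C ∧ `TwistedPerfectDoor` ∧ the family fact ∧ `OneSplitWeilAnchorTwistedCarriers R e₀ p`**, for every split `E`-Weil datum of type
`(R, e₀, p)`, `p > 1`: the `E`-Weil line of EVERY split structure of the type from ONE twisted carrier of ONE class at ONE anchor of our choice. NO CM hypothesis;
`HC_CM` absent. [cite: Andre1996Motifs, proof of Lemme 6.3.3 (p. 33)] [cite: Deligne1982HodgeCycles, §4 proof of Thm. 4.8] [cite: Pridham2024Semiregularity, Cor. 2.25 and Rem. 2.26–2.27] -/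
theorem weilClassesField_le_algebraicClasses_of_split_of_oneSplitWeilAnchorTwistedCarriers (hC : VHCAbelianSchemesRoad.ChernCharacterOnBetti)
    (hDoor : VHCAbelianSchemesRoad.TwistedPerfectDoor) (h : andre1996_weilLineFamily_throughSplitAnchor) (hone : OneSplitWeilAnchorTwistedCarriers R e₀ p)
    (hp : 1 < p) (hB : IsWeilTypeCM B η R e₀ p) (ha : IsRationalClass a) (ha₀ : a ≠ 0)
    (hRos : ∀ x y : complexBetti B.X 1,
      polarizationPairingOne B.X (complexBetti.map e.ι 2 a) (B.dim - 1) (pullbackOne B η x) y =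
        -polarizationPairingOne B.X (complexBetti.map e.ι 2 a) (B.dim - 1) x (pullbackOne B η y))
    (hsplit : IsHyperbolicWeilType B η (p * e₀) (complexBetti.map e.ι 2 a)) :
    weilClassesField B η (R.comp (Polynomial.X ^ 2)) (2 * p) ≤ algebraicClasses B.X p := by
  obtain ⟨C⟩ := (hC : Nonempty ChernCharacterBetti)
  exact weilClassesField_le_algebraicClasses_of_split_of_throughSplitAnchor_of_door_of_oneSplitWeilAnchorCarriers h
    ((twistedPerfectDoorVHC_iff_localVariationalHodgeFor C _).1 (hDoor C)) (hone C) hp hB ha ha₀ hRos hsplit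

/-- **THE `(6,3)` QUADRATIC CELL: the codimension-3 Weil classes of EVERY split Weil sixfold with imaginary-quadratic multiplication ⟸ K-C ∧ TwistedPerfectDoor ∧ the family
fact ∧ `QuadraticSplitSixfoldAnchorOneTwistedCarrier`** (one twisted carrier of one class at ONE split sixfold of our choice per field — Markman's twisted secant sheaf,
preprint; in print the conclusion is Markman's Thm. 1.5.1). [cite: Markman2025SecantWeil, Thm. 1.4.1, §1.5 and Thm. 1.5.1] [cite: Andre1996Motifs, proof of Lemme 6.3.3 (p. 33)] -/
theorem weilClassesField_le_algebraicClasses_splitSixfold_of_quadraticSplitSixfoldAnchorOneTwistedCarrier (hC : VHCAbelianSchemesRoad.ChernCharacterOnBetti)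
    (hDoor : VHCAbelianSchemesRoad.TwistedPerfectDoor) (h : andre1996_weilLineFamily_throughSplitAnchor) (hQ : QuadraticSplitSixfoldAnchorOneTwistedCarrier)
    (hB : IsWeilTypeCM B η R 1 3) (ha : IsRationalClass a) (ha₀ : a ≠ 0)
    (hRos : ∀ x y : complexBetti B.X 1,
      polarizationPairingOne B.X (complexBetti.map e.ι 2 a) (B.dim - 1) (pullbackOne B η x) y =
        -polarizationPairingOne B.X (complexBetti.map e.ι 2 a) (B.dim - 1) x (pullbackOne B η y))
    (hsplit : IsHyperbolicWeilType B η (3 * 1) (complexBetti.map e.ι 2 a)) :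
    weilClassesField B η (R.comp (Polynomial.X ^ 2)) (2 * 3) ≤ algebraicClasses B.X 3 :=
  weilClassesField_le_algebraicClasses_of_split_of_oneSplitWeilAnchorTwistedCarriers hC hDoor h (hQ R B η e a hB ha ha₀ hRos hsplit) (by norm_num) hB ha
    ha₀ hRos hsplit

/-- **THE `(8,2)` QUARTIC CELL: the codimension-2 Weil classes of EVERY split Weil eightfold with multiplication by a quartic CM field ⟸ K-C ∧ TwistedPerfectDoor ∧ the family
fact ∧ `QuarticSplitEightfoldAnchorOneTwistedCarrier`** (one twisted carrier of one class at ONE split eightfold of our choice per field — the K3-partner habitat; OPEN).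
[cite: Markman2025SecantRealMultiplication, §1.1] [cite: Andre2026, §4.4.4] [cite: Andre1996Motifs, proof of Lemme 6.3.3 (p. 33)] -/
theorem weilClassesField_le_algebraicClasses_quarticSplitEightfold_of_quarticSplitEightfoldAnchorOneTwistedCarrier
    (hC : VHCAbelianSchemesRoad.ChernCharacterOnBetti) (hDoor : VHCAbelianSchemesRoad.TwistedPerfectDoor) (h : andre1996_weilLineFamily_throughSplitAnchor)
    (hQ : QuarticSplitEightfoldAnchorOneTwistedCarrier) (hB : IsWeilTypeCM B η R 2 2) (ha : IsRationalClass a) (ha₀ : a ≠ 0)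
    (hRos : ∀ x y : complexBetti B.X 1,
      polarizationPairingOne B.X (complexBetti.map e.ι 2 a) (B.dim - 1) (pullbackOne B η x) y =
        -polarizationPairingOne B.X (complexBetti.map e.ι 2 a) (B.dim - 1) x (pullbackOne B η y))
    (hsplit : IsHyperbolicWeilType B η (2 * 2) (complexBetti.map e.ι 2 a)) :
    weilClassesField B η (R.comp (Polynomial.X ^ 2)) (2 * 2) ≤ algebraicClasses B.X 2 :=
  weilClassesField_le_algebraicClasses_of_split_of_oneSplitWeilAnchorTwistedCarriers hC hDoor h (hQ R B η e a hB ha ha₀ hRos hsplit) (by norm_num) hB ha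
    ha₀ hRos hsplit

/-- **THE `(8,4)` QUADRATIC CELL: the codimension-4 Weil classes of EVERY split Weil eightfold with imaginary-quadratic multiplication ⟸ K-C ∧ TwistedPerfectDoor ∧ the family
fact ∧ `QuadraticSplitEightfoldAnchorOneTwistedCarrier`** (one twisted carrier of one class at ONE split eightfold of our choice per field — the Weil ladder's rung R2₈
in André's format; OPEN). [cite: Markman2025SecantWeil, §1.2] [cite: Andre1996Motifs, proof of Lemme 6.3.3 (p. 33)] [cite: Deligne1982HodgeCycles, §4 proof of Thm. 4.8] -/
theorem weilClassesField_le_algebraicClasses_quadraticSplitEightfold_of_quadraticSplitEightfoldAnchorOneTwistedCarrier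
    (hC : VHCAbelianSchemesRoad.ChernCharacterOnBetti) (hDoor : VHCAbelianSchemesRoad.TwistedPerfectDoor) (h : andre1996_weilLineFamily_throughSplitAnchor)
    (hQ : QuadraticSplitEightfoldAnchorOneTwistedCarrier) (hB : IsWeilTypeCM B η R 1 4) (ha : IsRationalClass a) (ha₀ : a ≠ 0)
    (hRos : ∀ x y : complexBetti B.X 1,
      polarizationPairingOne B.X (complexBetti.map e.ι 2 a) (B.dim - 1) (pullbackOne B η x) y =
        -polarizationPairingOne B.X (complexBetti.map e.ι 2 a) (B.dim - 1) x (pullbackOne B η y))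
    (hsplit : IsHyperbolicWeilType B η (4 * 1) (complexBetti.map e.ι 2 a)) :
    weilClassesField B η (R.comp (Polynomial.X ^ 2)) (2 * 4) ≤ algebraicClasses B.X 4 :=
  weilClassesField_le_algebraicClasses_of_split_of_oneSplitWeilAnchorTwistedCarriers hC hDoor h (hQ R B η e a hB ha ha₀ hRos hsplit) (by norm_num) hB ha
    ha₀ hRos hsplit

/-! ## §2 `AndreSplitWeilClasses` (every CM field, every `p ≥ 1`) from one carried class at one split anchor per inhabited type -/

/-- **`AndreSplitWeilClasses ⟸ the door for 𝒪 ∧ the family fact ∧ (∀ inhabited types with p > 1, OneSplitWeilAnchorCarriers 𝒪 R e₀ p)`** (door-generic): `p = 1` by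
Lefschetz `(1,1)` (Weil classes of a Weil-type datum are of type `(p,p)`, Moonen–Zarhin's criterion); `p ≥ 2` by §1, the datum itself witnessing that its type is
inhabited. [cite: Andre1996Motifs, §6.3 b)–c) (pp. 32–33)] [cite: MoonenZarhin1998WeilClasses, §1] [cite: VoisinHodgeI2002, Thm. 11.30] [cite: Bloch1972Semiregularity, Remark (7.5)] -/
theorem andreSplitWeilClasses_of_throughSplitAnchor_of_door_of_oneSplitWeilAnchorCarriers {𝒪 : ObjClass} (h : andre1996_weilLineFamily_throughSplitAnchor)
    (hT : LocalVariationalHodgeFor 𝒪)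
    (hall : ∀ (R : Polynomial ℤ) (e₀ p : ℕ), 1 < p →
      ∀ (B : AbelianVariety ℂ) (η : B ⟶ B) (e : ProjectiveEmbedding B.X) (a : complexBetti (projectiveSpace e.n ℂ) 2),
        IsWeilTypeCM B η R e₀ p → IsRationalClass a → a ≠ 0 →
        (∀ x y : complexBetti B.X 1,
          polarizationPairingOne B.X (complexBetti.map e.ι 2 a) (B.dim - 1) (pullbackOne B η x) y =
            -polarizationPairingOne B.X (complexBetti.map e.ι 2 a) (B.dim - 1) x (pullbackOne B η y)) →
        IsHyperbolicWeilType B η (p * e₀) (complexBetti.map e.ι 2 a) → OneSplitWeilAnchorCarriers 𝒪 R e₀ p) :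
    AndreSplitWeilClasses := by
  intro B η R e₀ p e a hB ha ha₀ hRos hsplit w hw hwQ
  obtain _ | _ | p := p
  · exact absurd hB.k_pos (lt_irrefl 0)
  · exact lefschetzOneOne_rational_holds hB.isSmoothProjective w hwQ
      (hB.isOfHodgeType_of_mem_weilClassesField MoonenZarhin1998_weilClasses_hodgeCriterion_holds hw)
  · exact weilClassesField_le_algebraicClasses_of_split_of_throughSplitAnchor_of_door_of_oneSplitWeilAnchorCarriers h hT
      (hall R e₀ (p + 2) (by omega) B η e a hB ha ha₀ hRos hsplit) (by omega) hB ha ha₀ hRos hsplit hw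

/-- **`AndreSplitWeilClasses ⟸ K-C ∧ TwistedPerfectDoor ∧ the family fact ∧ OneSplitWeilAnchorTwistedCarriersAll`**: the Weil classes of the split `E`-Weil structures of
EVERY CM field `E`, every `p ≥ 1`, from ONE twisted carrier of ONE class at ONE split anchor of our choice per inhabited type `(E, p)`, `p ≥ 2`. NO CM hypothesis;
`HC_CM` absent. [cite: Andre1996Motifs, §6.3 b)–c) (pp. 32–33)] [cite: Deligne1982HodgeCycles, §4 proof of Thm. 4.8] [cite: MoonenZarhin1998WeilClasses, §1]
[cite: Pridham2024Semiregularity, Cor. 2.25 and Rem. 2.26–2.27] -/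
theorem andreSplitWeilClasses_of_oneSplitWeilAnchorTwistedCarriersAll (hC : VHCAbelianSchemesRoad.ChernCharacterOnBetti)
    (hDoor : VHCAbelianSchemesRoad.TwistedPerfectDoor) (h : andre1996_weilLineFamily_throughSplitAnchor) (hall : OneSplitWeilAnchorTwistedCarriersAll) :
    AndreSplitWeilClasses := by
  obtain ⟨C⟩ := (hC : Nonempty ChernCharacterBetti)
  exact andreSplitWeilClasses_of_throughSplitAnchor_of_door_of_oneSplitWeilAnchorCarriers h ((twistedPerfectDoorVHC_iff_localVariationalHodgeFor C _).1 (hDoor C))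
    fun R e₀ p hp B η e a hB ha ha₀ hRos hsplit ↦ hall R e₀ p hp B η e a hB ha ha₀ hRos hsplit C

/-! ## §3 `HC_CM` from one carried class at one split anchor per inhabited type (Lemme 6.3.2 is a theorem of the tree) -/

/-- **`HC_CM ⟸ K-C ∧ TwistedPerfectDoor ∧ Kodaira ∧ the family fact ∧ OneSplitWeilAnchorTwistedCarriersAll`**: the Hodge conjecture for CM abelian varieties from ONE
semiregular twisted representative, modulo the `θ`-ray, of ONE non-zero rational `E`-Weil class on ONE split anchor OF OUR CHOICE per inhabited type `(E, p)` —
André's CM reduction (Lemme 6.3.2 = André 1992) being CorCM's KERNEL theorem, Kodaira turning its polarization classes into hyperplane classes.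
[cite: Andre1996Motifs, §6.3 Lemmes 6.3.2–6.3.3 (pp. 32–33)] [cite: Andre1992HodgeCM, Théorème] [cite: Deligne1982HodgeCycles, §4 proof of Thm. 4.8]
[cite: Huybrechts2005, Prop. 5.3.1, Cor. 5.3.3] [cite: Pridham2024Semiregularity, Cor. 2.25 and Rem. 2.26–2.27] [cite: Milne1999, §7 p. 72] -/
theorem HC_CM_of_kodaira_of_throughSplitAnchor_of_oneSplitWeilAnchorTwistedCarriersAll (hC : VHCAbelianSchemesRoad.ChernCharacterOnBetti)
    (hDoor : VHCAbelianSchemesRoad.TwistedPerfectDoor) (hK : Kodaira1954_rationalKaehlerClass_eq_hyperplaneClass) (h : andre1996_weilLineFamily_throughSplitAnchor)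
    (hall : OneSplitWeilAnchorTwistedCarriersAll) : RankFourFaces.CMAbelianHodge :=
  fun B hB' hcm ↦ cmHodgeHypothesisAt_of_kodaira_of_andreSplitWeilClasses hK (andreSplitWeilClasses_of_oneSplitWeilAnchorTwistedCarriersAll hC hDoor h hall)
    B hB' hcm

/-! ## §4 `HC_AV` with `HC_CM` idle — the André column's `B_min` of gen 63 -/

/-- **`HC_AV ⟸ K-C ∧ TwistedPerfectDoor ∧ Kodaira ∧ AndreCMAnchoredPencil ∧ the family fact ∧ CMAlgebraicTwistedCarriers ∧ OneSplitWeilAnchorTwistedCarriersAll`** — THE ANDRÉ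
COLUMN'S `B_min` OF GEN 63 (`HC_CM` IDLE): besides the road's binders (K-C, the door, Lemme 6.3.1), Kodaira's embedding theorem and ONE André∕Deligne family fact (all
theorems in print), TWO carrier statements — semiregular twisted representatives, modulo the `θ`-ray, (i) of KNOWN ALGEBRAIC classes of codimension `2 ≤ p`,
`2p + 4 ≤ n` on polarised CM abelian `n`-folds, and (ii) of ONE non-zero rational `E`-Weil class on ONE split anchor OF OUR CHOICE per inhabited type `(E, p)`, `p ≥ 2`
(gen 62 asked (ii) at EVERY tensor structure over an anchor variety per codimension; the `(E quadratic, p = 3)` conjunct of (ii) is Markman's theorem, preprint,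
modulo typing). [cite: Andre1996Motifs, §6.3 (pp. 31–33)] [cite: Andre1992HodgeCM, Théorème] [cite: Deligne1982HodgeCycles, §4 proof of Thm. 4.8]
[cite: Markman2025SecantWeil, Thm. 1.4.1 and §1.5] [cite: Bloch1972Semiregularity, Remark (7.5)] [cite: Pridham2024Semiregularity, Cor. 2.25 and Rem. 2.26–2.27] -/
theorem HC_AV_of_kodaira_of_cmAlgebraic_and_oneSplitWeilAnchor_twistedCarriers (hC : VHCAbelianSchemesRoad.ChernCharacterOnBetti)
    (hDoor : VHCAbelianSchemesRoad.TwistedPerfectDoor) (hK : Kodaira1954_rationalKaehlerClass_eq_hyperplaneClass) (h₂₁ : VHCAbelianSchemesRoad.AndreCMAnchoredPencil)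
    (h : andre1996_weilLineFamily_throughSplitAnchor) (hcm : CMAlgebraicTwistedCarriers) (hall : OneSplitWeilAnchorTwistedCarriersAll) :
    PadicSemiregularLift.HodgeAbelianVarieties := by
  have hS := andreSplitWeilClasses_of_oneSplitWeilAnchorTwistedCarriersAll hC hDoor h hall
  obtain ⟨C⟩ := (hC : Nonempty ChernCharacterBetti)
  exact fun A ↦ forall_hodgeConjectureFor_of_kodaira_of_andre1996_of_andreSplitWeilClasses_of_door_of_cmAlgebraic h₂₁ hK
    ((twistedPerfectDoorVHC_iff_localVariationalHodgeFor C _).1 (hDoor C)) (fun n p h2 h4 ↦ hcm C n p h2 h4) hS A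

/-- **Both axes at once**: K-C ∧ TwistedPerfectDoor ∧ Kodaira ∧ the family fact ∧ `OneSplitWeilAnchorTwistedCarriersAll` ⟹ `HC_CM ∧ AndreSplitWeilClasses`.
[cite: Andre1996Motifs, §6.3 (pp. 32–33)] [cite: Andre1992HodgeCM, Théorème] [cite: Deligne1982HodgeCycles, §4 proof of Thm. 4.8] -/
theorem HC_CM_and_andreSplitWeilClasses_of_oneSplitWeilAnchorTwistedCarriersAll (hC : VHCAbelianSchemesRoad.ChernCharacterOnBetti)
    (hDoor : VHCAbelianSchemesRoad.TwistedPerfectDoor) (hK : Kodaira1954_rationalKaehlerClass_eq_hyperplaneClass) (h : andre1996_weilLineFamily_throughSplitAnchor)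
    (hall : OneSplitWeilAnchorTwistedCarriersAll) : RankFourFaces.CMAbelianHodge ∧ AndreSplitWeilClasses :=
  ⟨HC_CM_of_kodaira_of_throughSplitAnchor_of_oneSplitWeilAnchorTwistedCarriersAll hC hDoor hK h hall,
    andreSplitWeilClasses_of_oneSplitWeilAnchorTwistedCarriersAll hC hDoor h hall⟩

/-! ## §5 (appended) The CHART (`∀∃`) nodes: lattice `∃∀ ⟹ ∀∃`, the rows again, and `B_min` of gen 63 in its smaller form -/

section Chart

open Summit.HodgeConjecture.HodgeConjecture.Ring2.SemiregularRepresentatives (weilClassesField_le_algebraicClasses_of_throughSplitAnchor_of_door_of_chartCarried)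

/-- **Lattice `∃∀ ⟹ ∀∃`**: `OneSplitWeilAnchorCarriers 𝒪 R e₀ p → OneSplitWeilAnchorChartCarriers 𝒪 R e₀ p` (at the chart `(X, ε, θ)` carry `ε^{-1 *}w₀`).
[cite: Bloch1972Semiregularity, Remark (7.5)] -/
theorem oneSplitWeilAnchorChartCarriers_of_oneSplitWeilAnchorCarriers {𝒪 : ObjClass} (h : OneSplitWeilAnchorCarriers 𝒪 R e₀ p) :
    OneSplitWeilAnchorChartCarriers 𝒪 R e₀ p := by
  obtain ⟨X₀, η₀, e', a', w₀, hX₀, ha', ha'₀, hRos₀, hsplit₀, hw₀W, hw₀Q, hw₀0, hcar⟩ := h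
  refine ⟨X₀, η₀, e', a', hX₀, ha', ha'₀, hRos₀, hsplit₀, fun X ε θ c hc hεθ hθ ↦ ⟨complexBetti.map ε.inv (2 * p) w₀, hw₀Q.pullback _, ?_, ?_, hcar X ε θ c hc hεθ hθ⟩⟩
  · intro h0
    apply hw₀0
    rw [← ε.complexBetti_map_hom_map_inv (2 * p) w₀, h0, map_zero]
  · rw [ε.complexBetti_map_hom_map_inv]
    exact hw₀W

/-- Lattice, twisted door: `OneSplitWeilAnchorTwistedCarriers R e₀ p → OneSplitWeilAnchorChartTwistedCarriers R e₀ p`. [cite: Bloch1972Semiregularity, Remark (7.5)] -/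
theorem oneSplitWeilAnchorChartTwistedCarriers_of_oneSplitWeilAnchorTwistedCarriers (h : OneSplitWeilAnchorTwistedCarriers R e₀ p) :
    OneSplitWeilAnchorChartTwistedCarriers R e₀ p :=
  fun C ↦ oneSplitWeilAnchorChartCarriers_of_oneSplitWeilAnchorCarriers (h C)

/-- Lattice, all inhabited types: `OneSplitWeilAnchorTwistedCarriersAll → OneSplitWeilAnchorChartTwistedCarriersAll`. [cite: Bloch1972Semiregularity, Remark (7.5)] -/
theorem oneSplitWeilAnchorChartTwistedCarriersAll_of_oneSplitWeilAnchorTwistedCarriersAll (h : OneSplitWeilAnchorTwistedCarriersAll) :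
    OneSplitWeilAnchorChartTwistedCarriersAll :=
  fun R e₀ p hp B η e a hB ha ha₀ hRos hsplit ↦
    oneSplitWeilAnchorChartTwistedCarriers_of_oneSplitWeilAnchorTwistedCarriers (h R e₀ p hp B η e a hB ha ha₀ hRos hsplit)

/-- **`W_E(B) ⊗ ℂ` algebraic ⟸ the door for `𝒪` ∧ the family fact ∧ `OneSplitWeilAnchorChartCarriers 𝒪 R e₀ p`** (`∀∃` node), for every split datum of type `(R, e₀, p)`,
`p > 1`. [cite: Andre1996Motifs, proof of Lemme 6.3.3 (p. 33)] [cite: Deligne1982HodgeCycles, §4 proof of Thm. 4.8] [cite: Bloch1972Semiregularity, Remark (7.5)] -/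
theorem weilClassesField_le_algebraicClasses_of_split_of_throughSplitAnchor_of_door_of_oneSplitWeilAnchorChartCarriers {𝒪 : ObjClass}
    (h : andre1996_weilLineFamily_throughSplitAnchor) (hT : LocalVariationalHodgeFor 𝒪) (hone : OneSplitWeilAnchorChartCarriers 𝒪 R e₀ p) (hp : 1 < p)
    (hB : IsWeilTypeCM B η R e₀ p) (ha : IsRationalClass a) (ha₀ : a ≠ 0)
    (hRos : ∀ x y : complexBetti B.X 1,
      polarizationPairingOne B.X (complexBetti.map e.ι 2 a) (B.dim - 1) (pullbackOne B η x) y =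
        -polarizationPairingOne B.X (complexBetti.map e.ι 2 a) (B.dim - 1) x (pullbackOne B η y))
    (hsplit : IsHyperbolicWeilType B η (p * e₀) (complexBetti.map e.ι 2 a)) :
    weilClassesField B η (R.comp (Polynomial.X ^ 2)) (2 * p) ≤ algebraicClasses B.X p := by
  obtain ⟨X₀, η₀, e', a', hX₀, ha', ha'₀, hRos₀, hsplit₀, hcar⟩ := hone
  exact weilClassesField_le_algebraicClasses_of_throughSplitAnchor_of_door_of_chartCarried h hT hp hX₀ ha' ha'₀ hRos₀ hsplit₀ hcar hB ha ha₀ hRos hsplit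

/-- **`W_E(B) ⊗ ℂ` algebraic ⟸ K-C ∧ TwistedPerfectDoor ∧ the family fact ∧ `OneSplitWeilAnchorChartTwistedCarriers R e₀ p`**, every split datum of the type, `p > 1`.
[cite: Andre1996Motifs, proof of Lemme 6.3.3 (p. 33)] [cite: Deligne1982HodgeCycles, §4 proof of Thm. 4.8] [cite: Pridham2024Semiregularity, Cor. 2.25 and Rem. 2.26–2.27] -/
theorem weilClassesField_le_algebraicClasses_of_split_of_oneSplitWeilAnchorChartTwistedCarriers (hC : VHCAbelianSchemesRoad.ChernCharacterOnBetti)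
    (hDoor : VHCAbelianSchemesRoad.TwistedPerfectDoor) (h : andre1996_weilLineFamily_throughSplitAnchor) (hone : OneSplitWeilAnchorChartTwistedCarriers R e₀ p)
    (hp : 1 < p) (hB : IsWeilTypeCM B η R e₀ p) (ha : IsRationalClass a) (ha₀ : a ≠ 0)
    (hRos : ∀ x y : complexBetti B.X 1,
      polarizationPairingOne B.X (complexBetti.map e.ι 2 a) (B.dim - 1) (pullbackOne B η x) y =
        -polarizationPairingOne B.X (complexBetti.map e.ι 2 a) (B.dim - 1) x (pullbackOne B η y))
    (hsplit : IsHyperbolicWeilType B η (p * e₀) (complexBetti.map e.ι 2 a)) :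
    weilClassesField B η (R.comp (Polynomial.X ^ 2)) (2 * p) ≤ algebraicClasses B.X p := by
  obtain ⟨C⟩ := (hC : Nonempty ChernCharacterBetti)
  exact weilClassesField_le_algebraicClasses_of_split_of_throughSplitAnchor_of_door_of_oneSplitWeilAnchorChartCarriers h
    ((twistedPerfectDoorVHC_iff_localVariationalHodgeFor C _).1 (hDoor C)) (hone C) hp hB ha ha₀ hRos hsplit

/-- **`AndreSplitWeilClasses ⟸ the door for 𝒪 ∧ the family fact ∧ (∀ inhabited types with p > 1, OneSplitWeilAnchorChartCarriers 𝒪 R e₀ p)`** (door-generic, `∀∃` nodes).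
[cite: Andre1996Motifs, §6.3 b)–c) (pp. 32–33)] [cite: MoonenZarhin1998WeilClasses, §1] [cite: Bloch1972Semiregularity, Remark (7.5)] -/
theorem andreSplitWeilClasses_of_throughSplitAnchor_of_door_of_oneSplitWeilAnchorChartCarriers {𝒪 : ObjClass} (h : andre1996_weilLineFamily_throughSplitAnchor)
    (hT : LocalVariationalHodgeFor 𝒪)
    (hall : ∀ (R : Polynomial ℤ) (e₀ p : ℕ), 1 < p →
      ∀ (B : AbelianVariety ℂ) (η : B ⟶ B) (e : ProjectiveEmbedding B.X) (a : complexBetti (projectiveSpace e.n ℂ) 2),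
        IsWeilTypeCM B η R e₀ p → IsRationalClass a → a ≠ 0 →
        (∀ x y : complexBetti B.X 1,
          polarizationPairingOne B.X (complexBetti.map e.ι 2 a) (B.dim - 1) (pullbackOne B η x) y =
            -polarizationPairingOne B.X (complexBetti.map e.ι 2 a) (B.dim - 1) x (pullbackOne B η y)) →
        IsHyperbolicWeilType B η (p * e₀) (complexBetti.map e.ι 2 a) → OneSplitWeilAnchorChartCarriers 𝒪 R e₀ p) :
    AndreSplitWeilClasses := by
  intro B η R e₀ p e a hB ha ha₀ hRos hsplit w hw hwQ
  obtain _ | _ | p := p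
  · exact absurd hB.k_pos (lt_irrefl 0)
  · exact lefschetzOneOne_rational_holds hB.isSmoothProjective w hwQ
      (hB.isOfHodgeType_of_mem_weilClassesField MoonenZarhin1998_weilClasses_hodgeCriterion_holds hw)
  · exact weilClassesField_le_algebraicClasses_of_split_of_throughSplitAnchor_of_door_of_oneSplitWeilAnchorChartCarriers h hT
      (hall R e₀ (p + 2) (by omega) B η e a hB ha ha₀ hRos hsplit) (by omega) hB ha ha₀ hRos hsplit hw

/-- **`AndreSplitWeilClasses ⟸ K-C ∧ TwistedPerfectDoor ∧ the family fact ∧ OneSplitWeilAnchorChartTwistedCarriersAll`** (`∀∃` nodes).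
[cite: Andre1996Motifs, §6.3 b)–c) (pp. 32–33)] [cite: Deligne1982HodgeCycles, §4 proof of Thm. 4.8] [cite: Pridham2024Semiregularity, Cor. 2.25 and Rem. 2.26–2.27] -/
theorem andreSplitWeilClasses_of_oneSplitWeilAnchorChartTwistedCarriersAll (hC : VHCAbelianSchemesRoad.ChernCharacterOnBetti)
    (hDoor : VHCAbelianSchemesRoad.TwistedPerfectDoor) (h : andre1996_weilLineFamily_throughSplitAnchor) (hall : OneSplitWeilAnchorChartTwistedCarriersAll) :
    AndreSplitWeilClasses := by
  obtain ⟨C⟩ := (hC : Nonempty ChernCharacterBetti)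
  exact andreSplitWeilClasses_of_throughSplitAnchor_of_door_of_oneSplitWeilAnchorChartCarriers h
    ((twistedPerfectDoorVHC_iff_localVariationalHodgeFor C _).1 (hDoor C)) fun R e₀ p hp B η e a hB ha ha₀ hRos hsplit ↦ hall R e₀ p hp B η e a hB ha ha₀ hRos hsplit C

/-- **`HC_CM ⟸ K-C ∧ TwistedPerfectDoor ∧ Kodaira ∧ the family fact ∧ OneSplitWeilAnchorChartTwistedCarriersAll`** (`∀∃` nodes; Lemme 6.3.2 kernel).
[cite: Andre1996Motifs, §6.3 Lemmes 6.3.2–6.3.3 (pp. 32–33)] [cite: Andre1992HodgeCM, Théorème] [cite: Huybrechts2005, Prop. 5.3.1, Cor. 5.3.3] [cite: Milne1999, §7 p. 72] -/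
theorem HC_CM_of_kodaira_of_throughSplitAnchor_of_oneSplitWeilAnchorChartTwistedCarriersAll (hC : VHCAbelianSchemesRoad.ChernCharacterOnBetti)
    (hDoor : VHCAbelianSchemesRoad.TwistedPerfectDoor) (hK : Kodaira1954_rationalKaehlerClass_eq_hyperplaneClass) (h : andre1996_weilLineFamily_throughSplitAnchor)
    (hall : OneSplitWeilAnchorChartTwistedCarriersAll) : RankFourFaces.CMAbelianHodge :=
  fun B hB' hcm ↦ cmHodgeHypothesisAt_of_kodaira_of_andreSplitWeilClasses hK (andreSplitWeilClasses_of_oneSplitWeilAnchorChartTwistedCarriersAll hC hDoor h hall)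
    B hB' hcm

/-- **`HC_AV ⟸ K-C ∧ TwistedPerfectDoor ∧ Kodaira ∧ AndreCMAnchoredPencil ∧ the family fact ∧ CMAlgebraicTwistedCarriers ∧ OneSplitWeilAnchorChartTwistedCarriersAll`** — `B_min` OF
GEN 63 IN ITS SMALLER (`∀∃`) FORM (`HC_CM` IDLE): carrier input (ii) asks, per inhabited type `(E, p)` with `p ≥ 2`, ONE split anchor of our choice at whose every chart
SOME non-zero rational `E`-Weil class carries an AdmTw-admissible twisted complex modulo the `θ`-ray. [cite: Andre1996Motifs, §6.3 (pp. 31–33)] [cite: Andre1992HodgeCM, Théorème]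
[cite: Deligne1982HodgeCycles, §4 proof of Thm. 4.8] [cite: Bloch1972Semiregularity, Remark (7.5)] [cite: Pridham2024Semiregularity, Cor. 2.25 and Rem. 2.26–2.27] -/
theorem HC_AV_of_kodaira_of_cmAlgebraic_and_oneSplitWeilAnchorChart_twistedCarriers (hC : VHCAbelianSchemesRoad.ChernCharacterOnBetti)
    (hDoor : VHCAbelianSchemesRoad.TwistedPerfectDoor) (hK : Kodaira1954_rationalKaehlerClass_eq_hyperplaneClass) (h₂₁ : VHCAbelianSchemesRoad.AndreCMAnchoredPencil)
    (h : andre1996_weilLineFamily_throughSplitAnchor) (hcm : CMAlgebraicTwistedCarriers) (hall : OneSplitWeilAnchorChartTwistedCarriersAll) :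
    PadicSemiregularLift.HodgeAbelianVarieties := by
  have hS := andreSplitWeilClasses_of_oneSplitWeilAnchorChartTwistedCarriersAll hC hDoor h hall
  obtain ⟨C⟩ := (hC : Nonempty ChernCharacterBetti)
  exact fun A ↦ forall_hodgeConjectureFor_of_kodaira_of_andre1996_of_andreSplitWeilClasses_of_door_of_cmAlgebraic h₂₁ hK
    ((twistedPerfectDoorVHC_iff_localVariationalHodgeFor C _).1 (hDoor C)) (fun n p h2 h4 ↦ hcm C n p h2 h4) hS A

end Chart

end Summit.HodgeConjecture.HodgeConjecture.Ring2.AbelianAll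

end
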